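import Summits.Ventures.Crystal3D.Theorems.StickyWulffConstantTextureBuildExposedFar
import HarnessLib

/-!
# TB-energy blueprint, stub_LP1 ROWS (P) (Q) (B): cells inside a prism, a gap piece or a riser box expose nothing outside the designated regions
# (lane T, crux `TextureLiminfV5`, stmt-Ventures-23912; TB-D-3-g20 §LP1 rows (P)(Q)(B); engine …ExposedFar)

HONEST FRAMING. Venture `Summits/Ventures/Crystal3D` (cell `crystal3d-full`), route `route-Ventures-StickyWulffConstant`, helper `--supports` the
law-v5 crux `TextureLiminfV5` (stmt-Ventures-23912).  Bookkeeping over the labelled cells of a texture input (standard axioms; no mesh constructed; F-C1 not moved).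

THE CONTAINER SCHEME (`exposed_container_eq_zero`).  A piece inside a mesh polytope `G` whose closure is material (prism / gap piece / box: their cells are
labelled) and whose non-designated facets are MATCHED (a ball around every facet point is covered by `closure G` and material sets) exposes nothing
outside the designated regions: at a generic exposed point either the far half-ball lies in `G` (material), or the point is on a facet `p′ ∈ G` with `p′ = q`
or `antip q` (genericity) — designated ⇒ accounted (either orientation, `Mesh₅.desOf`), matched ⇒ far side material.  Rows: `exposed_prism_eq_zero` (Δ1 `hPlat`
+ `hwrap₁/₂`), `exposed_gap_eq_zero` (Δ2 `hQmatch₅`), `exposed_box_eq_zero` (Δ2 `hBmatch₅`).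
-/

noncomputable section

open scoped BigOperators InnerProductSpace ENNReal
open MeasureTheory Set

namespace Summit.Ventures.Crystal3D.Cruxes.TextureLiminf.TexShadow

open Summit.Ventures.Crystal3D Summit.Ventures.Crystal3D.Theorems

namespace TexInput

variable {C R₀ : ℝ} {N : ℕ} {x : Fin N → E3} {rc : RiseredCover C R₀ N x} {δ : ℝ} {μ : Mesh₅ rc δ} (I : TexInput rc μ)

/-- A designated facet of the arrangement through a generic facet point is usable by the facet datum (either orientation). -/
theorem mem_desOf_of_mem_desSet {q : E3 × ℝ} {y : E3} (hgen : I.Generic q y) {G : Finset (E3 × ℝ)} (hG𝓗 : G ⊆ I.𝓗) {p : E3 × ℝ}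
    (hpG : p ∈ G) (hdes : (G, p) ∈ μ.desSet) (hy : y ∈ facetOf G p) : y ∈ μ.desOf q := by
  have hpq : p = q ∨ p = antip q := by
    by_contra h
    exact hgen p (hG𝓗 hpG) h hy.2
  have hor : (p.1 = q.1 ∧ p.2 = q.2) ∨ (-p.1 = q.1 ∧ -p.2 = q.2) := by
    rcases hpq with rfl | rfl
    · exact Or.inl ⟨rfl, rfl⟩
    · exact Or.inr ⟨by simp [antip], by simp [antip]⟩
  simp only [Mesh₅.desOf, mem_iUnion, Finset.mem_filter, exists_prop]
  exact ⟨(G, p), ⟨hdes, hor⟩, hy⟩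

/-- **THE CONTAINER SCHEME.**  A piece inside a material, matched mesh polytope exposes nothing outside the designated regions. -/
theorem exposed_container_eq_zero (i : Fin I.cells.M) {G : Finset (E3 × ℝ)} (hG𝓗 : G ⊆ I.𝓗) (hGi : polytope (I.cells.Hp i) ⊆ polytope G)
    (hGmat : ∀ z ∈ closure (polytope G), z ∉ I.massNull → z ∈ I.pieceSet)
    (hmatch : ∀ p' ∈ G, (G, p') ∉ μ.desSet → ∀ y ∈ facetOf G p', ∃ r : ℝ, 0 < r ∧
      ∀ z ∈ Metric.ball y r, z ∉ I.massNull → z ∈ I.pieceSet)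
    {q : E3 × ℝ} (hq : q ∈ I.cells.Hp i) : facetArea (I.exposed i q \ μ.desOf q) q.1 = 0 := by
  refine I.facetArea_exposed_diff_eq_zero i hq _ fun y hyE hyA hgen => ?_
  have hycl : y ∈ closure (polytope G) := closure_mono hGi hyE.1.1
  by_cases hyG : y ∈ polytope G
  · -- interior point of the container: the far half-ball is inside it
    obtain ⟨ε, hε, hball⟩ := Metric.isOpen_iff.1 (isOpen_polytopeH G) y hyG
    exact ⟨ε, hε, fun z hz _ hzN => hGmat z (subset_closure (hball hz)) hzN⟩
  · -- boundary point: on a facet `p′ ∈ G`, generic ⇒ `p′ = q` or `antip q`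
    have hex : ∃ p' ∈ G, ⟪p'.1, y⟫_ℝ = p'.2 := by
      by_contra h
      simp only [not_exists, not_and] at h
      apply hyG
      simp only [polytope, mem_iInter, mem_setOf_eq]
      exact fun p' hp' => lt_of_le_of_ne (inner_le_of_mem_closure_polytope G hycl p' hp') (h p' hp')
    obtain ⟨p', hp'G, hyp'⟩ := hex
    have hyfacet : y ∈ facetOf G p' := ⟨hycl, hyp'⟩
    by_cases hdes : (G, p') ∈ μ.desSet
    · exact absurd (I.mem_desOf_of_mem_desSet hgen hG𝓗 hp'G hdes hyfacet) hyA
    · obtain ⟨r, hr, hfar⟩ := hmatch p' hp'G hdes y hyfacet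
      exact ⟨r, hr, fun z hz _ hzN => hfar z hz hzN⟩

/-! ### ROW (P): prism cells -/

/-- Non-designated prism data are not lateral-designated. -/
theorem not_mem_latP_of_not_desSet (μ : Mesh₅ rc δ) {k : Fin rc.nk} {p : E3 × ℝ} (h : (μ.HP k, p) ∉ μ.desSet) : p ∉ μ.latP k :=
  fun hp => h (μ.mem_desSet_P hp)

/-- **ROW (P) of stub_LP1 — PRISM cells expose nothing outside the designated regions** (Δ1 `hPlat`: non-lateral facets are wrapped; `hwrap₁/₂`). -/
theorem exposed_prism_eq_zero (i : Fin I.cells.M) {k : Fin rc.nk} (hP : polytope (I.cells.Hp i) ⊆ polytope (μ.HP k)) {q : E3 × ℝ}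
    (hq : q ∈ I.cells.Hp i) : facetArea (I.exposed i q \ μ.desOf q) q.1 = 0 := by
  refine I.exposed_container_eq_zero i (I.HP_subset_𝓗 k) hP (fun z hz hzN => I.mem_pieceSet_of_prism k hz hzN) (fun p' hp' hdes y hy => ?_) hq
  have hwr := μ.hPlat k p' (Finset.mem_sdiff.2 ⟨hp', not_mem_latP_of_not_desSet μ hdes⟩) y hy
  -- wrapped heights: the wrap clauses give a ball covered by the closed prism and guarded territory
  have hmat : ∀ (g : Fin rc.ng) {r : ℝ}, Metric.ball y r ⊆ closure (polytope (μ.HP k)) ∪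
      {z | z ∈ closure (⋃ j, polytope (μ.HD g j)) ∧ (z ∈ (rc.tent g).U → rc.SolidAt g z)} →
      ∀ z ∈ Metric.ball y r, z ∉ I.massNull → z ∈ I.pieceSet := by
    intro g r hball z hz hzN
    rcases hball hz with hzP | ⟨hzD, hguard⟩
    · exact I.mem_pieceSet_of_prism k hzP hzN
    · exact I.mem_pieceSet_of_territory g hzD hguard hzN
  rcases hwr with hlow | hhigh
  · obtain ⟨r, hr, hball⟩ := μ.hwrap₁ k y hy.1 hlow
    exact ⟨r, hr, hmat (μ.fk k) hball⟩
  · obtain ⟨r, hr, hball⟩ := μ.hwrap₂ k y hy.1 hhigh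
    exact ⟨r, hr, hmat (μ.gk k) hball⟩

/-! ### ROWS (Q) and (B): gap-piece and riser-box cells -/

/-- The six material sets of a matching clause are material off the null set. -/
theorem mem_pieceSet_of_matchSets {g : Fin rc.ng} {Rset : Finset (Fin rc.nr)} {z : E3}
    (hz : z ∈ ({z | z ∈ closure (⋃ j, polytope (μ.HD g j)) ∧ (z ∈ (rc.tent g).U → rc.SolidAt g z)} ∪
        (⋃ k ∈ (Finset.univ.filter fun k => μ.fk k = g), (closure (polytope (μ.HP k)) ∩ {z | rc.height k z ≤ -1})) ∪
        (⋃ k ∈ (Finset.univ.filter fun k => μ.gk k = g), (closure (polytope (μ.HP k)) ∩ {z | (rc.cell k).h + 1 ≤ rc.height k z})) ∪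
        (⋃ l' ∈ (Finset.univ.filter fun l' => μ.lab l' = g), closure (polytope (μ.HQ l'))) ∪
        (⋃ r' ∈ Rset, closure (polytope (μ.HB r')))))
    (hzN : z ∉ I.massNull) : z ∈ I.pieceSet := by
  rcases hz with (((⟨hzD, hguard⟩ | hB) | hC) | hD) | hE
  · exact I.mem_pieceSet_of_territory g hzD hguard hzN
  · obtain ⟨k, -, hzk⟩ := mem_iUnion₂.1 hB
    exact I.mem_pieceSet_of_prism k hzk.1 hzN
  · obtain ⟨k, -, hzk⟩ := mem_iUnion₂.1 hC
    exact I.mem_pieceSet_of_prism k hzk.1 hzN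
  · obtain ⟨l', -, hzl⟩ := mem_iUnion₂.1 hD
    exact I.mem_pieceSet_of_gap l' hzl hzN
  · obtain ⟨r', -, hzr⟩ := mem_iUnion₂.1 hE
    exact I.mem_pieceSet_of_box r' hzr hzN

/-- **ROW (Q) of stub_LP1 — GAP-PIECE cells expose nothing outside the designated regions** (Δ2 `hQmatch₅`). -/
theorem exposed_gap_eq_zero (i : Fin I.cells.M) {l : Fin μ.nQ} (hQ : polytope (I.cells.Hp i) ⊆ polytope (μ.HQ l)) {q : E3 × ℝ}
    (hq : q ∈ I.cells.Hp i) : facetArea (I.exposed i q \ μ.desOf q) q.1 = 0 := by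
  refine I.exposed_container_eq_zero i (I.HQ_subset_𝓗 l) hQ (fun z hz hzN => I.mem_pieceSet_of_gap l hz hzN) (fun p' hp' hdes y hy => ?_) hq
  have hnd : p' ∉ μ.desQ l := fun h => hdes (μ.mem_desSet_Q h)
  obtain ⟨r, hr, hball⟩ := μ.hQmatch₅ l p' (Finset.mem_sdiff.2 ⟨hp', hnd⟩) y hy
  refine ⟨r, hr, fun z hz hzN => ?_⟩
  rcases hball hz with hzQ | hz6
  · exact I.mem_pieceSet_of_gap l hzQ hzN
  rcases hz6 with hz5 | hF
  · exact I.mem_pieceSet_of_matchSets hz5 hzN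
  · obtain ⟨g, -, hzg⟩ := mem_iUnion₂.1 hF
    exact I.mem_pieceSet_of_territory g hzg.1 hzg.2.1 hzN

/-- **ROW (B) of stub_LP1 — RISER-BOX cells expose nothing outside the designated regions** (Δ2 `hBmatch₅`). -/
theorem exposed_box_eq_zero (i : Fin I.cells.M) {r : Fin rc.nr} (hB : polytope (I.cells.Hp i) ⊆ polytope (μ.HB r)) {q : E3 × ℝ}
    (hq : q ∈ I.cells.Hp i) : facetArea (I.exposed i q \ μ.desOf q) q.1 = 0 := by
  refine I.exposed_container_eq_zero i (I.HB_subset_𝓗 r) hB (fun z hz hzN => I.mem_pieceSet_of_box r hz hzN) (fun p' hp' hdes y hy => ?_) hq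
  have hnd : p' ∉ μ.desB r := fun h => hdes (μ.mem_desSet_B h)
  obtain ⟨ρ', hρ', g, -, -, hball⟩ := μ.hBmatch₅ r p' (Finset.mem_sdiff.2 ⟨hp', hnd⟩) y hy
  refine ⟨ρ', hρ', fun z hz hzN => ?_⟩
  rcases hball hz with hzB | hz5
  · exact I.mem_pieceSet_of_box r hzB hzN
  · exact I.mem_pieceSet_of_matchSets hz5 hzN

end TexInput

end Summit.Ventures.Crystal3D.Cruxes.TextureLiminf.TexShadow

end
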